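import Literature.Analysis.FluidPDE.JiaSverak2014SliceStructure
import HarnessLib

/-!
# Jia–Šverák 2014, local higher regularity: the gain of one derivative

Analysis/FluidPDE proofs file (theorems only; no definitions, no named facts), part of the proof
of the named fact `Literature.Analysis.FluidPDE.jia_sverak_2014_local_higher_regularity`
(`JiaSverak2014LocalRegularity.lean`; H. Jia, V. Šverák, Invent. Math. 196 (2014) =
arXiv:1204.0529, §3 Thm 3.2 and the bootstrap remark after its proof, p. 9: the estimates of
the higher spatial derivatives near the initial time follow "by bootstrap arguments" from the
localised Duhamel formula). This file proves **one level of the bootstrap**: a representative of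
`u` with `C^{n,γ}` slices (universal bounds) on `B(x₀, ρ)` yields one with `C^{n+1,γ}` slices
(universal bounds) on `B(x₀, ρ')`, `ρ' < ρ`.

* `level_smul_const` — bookkeeping;
* `level_step` — the statement (docstring of the theorem). The slice structure
  (`exists_slice_structure`) gives `u_k(t) = V_k(t) - ∂_kQ(t)` weakly on `B(x₀,ρ₃)` for a.e. `t`,
  with `V(t) ∈ C^{n+1,γ}` and `Q(t) ∈ L¹`; since `u(t)` is weakly divergence free, `Q(t)` is a very
  weak solution of `ΔQ = div V` on `B(x₀, ρ₃)`, and the tree's interior theory of very weak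
  Poisson solutions (`PoissonWeyl.integral_mul_fderiv_apply_eq_of_veryWeakPoisson`: Weyl's lemma
  with source, the smoothing `Λ` of the far part and the near gradient potential `T⁰`) identifies
  its weak gradient on an inner ball with the smooth field `∇Λ[1_B Q(t)] + T⁰(η div V(t))`, whose
  `C^{n+1,γ}` bounds are universal (`exists_norm_iteratedFDeriv_newtonFarSmoothing_le`,
  `exists_newtonNear_level_bounds`). Hence `u(t) = V(t) - ∇Λ[1_BQ(t)] - T⁰(η div V(t))` a.e. on
  the inner ball, which is the new representative.

## References

* H. Jia, V. Šverák, Invent. Math. 196 (2014) = arXiv:1204.0529, §3 (p. 9). Bib key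
  `JiaSverak2014`.
* D. Gilbarg, N. S. Trudinger, *Elliptic Partial Differential Equations of Second Order* (2001),
  Lemmas 4.1, 4.2, 4.4 and Thm. 2.10. Bib key `GilbargTrudinger2001`.
-/

noncomputable section

open MeasureTheory TopologicalSpace Set Function Filter Metric
open _root_.Topology
open scoped ENNReal NNReal RealInnerProductSpace Laplacian

namespace Literature.Analysis.FluidPDE

namespace JiaSverak2014

open Literature.Analysis.UnboundedOperators LemarieRieusset2016

-- nested operator types
set_option maxSynthPendingDepth 3

/-! ## Scalar functions times a fixed vector -/

/-- `x ↦ g(x) • v` has the level bounds of `g` (unit `v`). [folklore] -/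
theorem level_smul_const {m : ℕ} {γ M : ℝ} {g : (EuclideanSpace ℝ (Fin 3)) → ℝ}
    (hg : ContDiff ℝ m g) (hgb : ∀ k ≤ m, ∀ x, ‖iteratedFDeriv ℝ k g x‖ ≤ M)
    (hgH : ∀ x y, ‖iteratedFDeriv ℝ m g x - iteratedFDeriv ℝ m g y‖ ≤ M * ‖x - y‖ ^ γ)
    {v : EuclideanSpace ℝ (Fin 3)} (hv : ‖v‖ ≤ 1) :
    ContDiff ℝ m (fun x => g x • v) ∧ (∀ k ≤ m, ∀ x, ‖iteratedFDeriv ℝ k (fun x => g x • v) x‖ ≤ M) ∧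
      ∀ x y, ‖iteratedFDeriv ℝ m (fun x => g x • v) x - iteratedFDeriv ℝ m (fun x => g x • v) y‖ ≤ M * ‖x - y‖ ^ γ := by
  set L : ℝ →L[ℝ] EuclideanSpace ℝ (Fin 3) := (ContinuousLinearMap.id ℝ ℝ).smulRight v with hL
  have hLn : ‖L‖ ≤ 1 := by
    refine ContinuousLinearMap.opNorm_le_bound _ zero_le_one fun r => ?_
    simp only [hL, ContinuousLinearMap.smulRight_apply, ContinuousLinearMap.id_apply, norm_smul, one_mul]
    calc ‖r‖ * ‖v‖ ≤ ‖r‖ * 1 := mul_le_mul_of_nonneg_left hv (norm_nonneg _)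
      _ = ‖r‖ := mul_one _
  have e : (fun x => g x • v) = L ∘ g := by funext x; simp [hL]
  have hM : 0 ≤ M := (norm_nonneg _).trans (hgb 0 (Nat.zero_le _) 0)
  rw [e]
  refine ⟨L.contDiff.comp hg, fun k hk x => ?_, fun x y => ?_⟩
  · rw [L.iteratedFDeriv_comp_left hg.contDiffAt (by exact_mod_cast hk)]
    calc _ ≤ ‖L‖ * ‖iteratedFDeriv ℝ k g x‖ := L.norm_compContinuousMultilinearMap_le _
      _ ≤ 1 * M := mul_le_mul hLn (hgb k hk x) (norm_nonneg _) zero_le_one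
      _ = M := one_mul _
  · rw [L.iteratedFDeriv_comp_left hg.contDiffAt (by exact_mod_cast le_rfl),
      L.iteratedFDeriv_comp_left hg.contDiffAt (by exact_mod_cast le_rfl)]
    have hlin : L.compContinuousMultilinearMap (iteratedFDeriv ℝ m g x) - L.compContinuousMultilinearMap (iteratedFDeriv ℝ m g y) =
        L.compContinuousMultilinearMap (iteratedFDeriv ℝ m g x - iteratedFDeriv ℝ m g y) := by
      ext w; simp
    rw [hlin]
    calc _ ≤ ‖L‖ * ‖iteratedFDeriv ℝ m g x - iteratedFDeriv ℝ m g y‖ := L.norm_compContinuousMultilinearMap_le _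
      _ ≤ 1 * (M * ‖x - y‖ ^ γ) := mul_le_mul hLn (hgH x y) (norm_nonneg _) zero_le_one
      _ = _ := one_mul _

/-! ## The level step -/

set_option maxHeartbeats 20000000 in
/-- **The gain of one derivative (one level of the bootstrap).** Fix `n`, `0 < γ < 1`, radii
`0 < ρ' < ρ ≤ 7/25`, `K_b ≥ 0`, `α_u`, datum bounds `A_d ≥ 0` and the level-`n` constant `𝒞 ≥ 0`.
There is `𝒞'` such that for every local Leray solution as in `exists_slice_structure` and every
level-`n` representative `R` of `u` on `B(x₀, ρ)` (jointly strongly measurable, `Cⁿ` slices,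
`‖DᵏR(t)‖ ≤ 𝒞` for `k ≤ n`, `[DⁿR(t)]_γ ≤ 𝒞`, `R(t) = u(t)` a.e. on `B(x₀,ρ)` for a.e. `t < T_b`)
there is a level-`(n+1)` representative `R'` of `u` on `B(x₀, ρ')` with constant `𝒞'`.
(Slice structure `u_k(t) = V_k(t) - ∂_kQ(t)` on `B(x₀,ρ₃)`; `div u(t) = 0` turns into the very weak
Poisson equation `ΔQ(t) = div V(t)` on `B(x₀,ρ₃)`, whose weak gradient on an inner ball is
`∇Λ[1_BQ(t)] + T⁰(η div V(t))`, smooth with universal bounds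
(`PoissonWeyl.integral_mul_fderiv_apply_eq_of_veryWeakPoisson`,
`exists_norm_iteratedFDeriv_newtonFarSmoothing_le`, `exists_newtonNear_level_bounds`); hence
`u(t) = R'(t) := V(t) - ∇Λ[1_BQ(t)] - T⁰(η div V(t))` a.e. on the inner ball.)
[cite: JiaSverak2014, §3 proof of Thm. 3.2 (arXiv p. 9)] -/
theorem level_step (n : ℕ) {γ : ℝ} (hγ0 : 0 < γ) (hγ1 : γ < 1) {ρ' ρ : ℝ} (hρ' : 0 < ρ')
    (hρ'ρ : ρ' < ρ) (hρ : ρ ≤ 7 / 25) {Kb : ℝ} (hKb : 0 ≤ Kb) (αu : ℝ≥0) {Ad : ℕ → ℝ} (hAd0 : ∀ k, 0 ≤ Ad k)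
    {𝒞 : ℝ} (h𝒞 : 0 ≤ 𝒞) :
    ∃ 𝒞' : ℝ, 0 ≤ 𝒞' ∧ ∀ {T' : ℝ} {x₀ : EuclideanSpace ℝ (Fin 3)}
      {u₀ : (EuclideanSpace ℝ (Fin 3)) → (EuclideanSpace ℝ (Fin 3))}
      {u : ℝ → (EuclideanSpace ℝ (Fin 3)) → (EuclideanSpace ℝ (Fin 3))} {p : ℝ → (EuclideanSpace ℝ (Fin 3)) → ℝ}
      {Tb Tb' : ℝ},
      AEStronglyMeasurable u₀ volume → IsLocalLeraySolutionOn T' 1 u₀ u p →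
      0 < Tb → Tb < Tb' → Tb' ≤ T' → Tb' ≤ 1 →
      ContDiffOn ℝ (⊤ : ℕ∞) u₀ (ball x₀ 1) →
      (∀ k, ∀ x ∈ ball x₀ 1, ‖iteratedFDeriv ℝ k u₀ x‖ ≤ Ad k) →
      (∀ᵐ z ∂(volume.restrict (Ioo 0 Tb' ×ˢ ball x₀ (7 / 12))), ‖u z.1 z.2‖ ≤ Kb) →
      (∀ᵐ t ∂(volume.restrict (Ioo 0 T')), ∀ z : EuclideanSpace ℝ (Fin 3), ∫⁻ x in ball z 1, ‖u t x‖ₑ ^ 2 ≤ αu) →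
      ∀ (R : ℝ → (EuclideanSpace ℝ (Fin 3)) → (EuclideanSpace ℝ (Fin 3))),
      StronglyMeasurable (uncurry R) → (∀ t, ContDiff ℝ n (R t)) →
      (∀ t, ∀ k ≤ n, ∀ x, ‖iteratedFDeriv ℝ k (R t) x‖ ≤ 𝒞) →
      (∀ t x y, ‖iteratedFDeriv ℝ n (R t) x - iteratedFDeriv ℝ n (R t) y‖ ≤ 𝒞 * ‖x - y‖ ^ γ) →
      (∀ᵐ t ∂(volume.restrict (Ioo 0 Tb)), ∀ᵐ x ∂(volume.restrict (ball x₀ ρ)), R t x = u t x) →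
      ∃ R' : ℝ → (EuclideanSpace ℝ (Fin 3)) → (EuclideanSpace ℝ (Fin 3)),
        StronglyMeasurable (uncurry R') ∧ (∀ t, ContDiff ℝ (n + 1) (R' t)) ∧
        (∀ t, ∀ k ≤ n + 1, ∀ x, ‖iteratedFDeriv ℝ k (R' t) x‖ ≤ 𝒞') ∧
        (∀ t x y, ‖iteratedFDeriv ℝ (n + 1) (R' t) x - iteratedFDeriv ℝ (n + 1) (R' t) y‖ ≤ 𝒞' * ‖x - y‖ ^ γ) ∧
        ∀ᵐ t ∂(volume.restrict (Ioo 0 Tb)), ∀ᵐ x ∂(volume.restrict (ball x₀ ρ')), R' t x = u t x := by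
  classical
  set b : OrthonormalBasis (Fin 3) ℝ (EuclideanSpace ℝ (Fin 3)) := EuclideanSpace.basisFun (Fin 3) ℝ with hb_def
  have hb1 : ∀ i, ‖b i‖ = 1 := fun i => b.orthonormal.1 i
  /- ## radii and universal constants -/
  set δ₀ : ℝ := (ρ - ρ') / 3 with hδ₀
  have hδ₀0 : 0 < δ₀ := by rw [hδ₀]; linarith
  set ρ₃ : ℝ := ρ - δ₀ with hρ₃
  have hρ₃0 : 0 < ρ₃ := by rw [hρ₃, hδ₀]; linarith
  have hρ₃ρ : ρ₃ < ρ := by rw [hρ₃]; linarith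
  have hρ'₃ : ρ' + δ₀ = ρ₃ - δ₀ := by rw [hρ₃, hδ₀]; ring
  have h₀ : 0 < δ₀ / 2 := by positivity
  have h₁ : δ₀ / 2 < δ₀ := by linarith
  -- the source cut-off `η` (`= 1` on `B̄(x₀, ρ₃)`)
  set η₀ : ContDiffBump (0 : EuclideanSpace ℝ (Fin 3)) := ⟨ρ₃, ρ, hρ₃0, hρ₃ρ⟩ with hη₀def
  have hη₀s : ContDiff ℝ (⊤ : ℕ∞) η₀ := η₀.contDiff
  have hη₀cs : HasCompactSupport (η₀ : EuclideanSpace ℝ (Fin 3) → ℝ) := η₀.hasCompactSupport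
  have hη₀supp : tsupport (η₀ : EuclideanSpace ℝ (Fin 3) → ℝ) = closedBall 0 ρ := η₀.tsupport_eq
  have hη₀one : ∀ y ∈ closedBall (0 : EuclideanSpace ℝ (Fin 3)) ρ₃, η₀ y = 1 := fun y hy => η₀.one_of_mem_closedBall hy
  have hYex : ∀ m : ℕ, ∃ Ym : ℝ, ∀ y, ‖iteratedFDeriv ℝ m (η₀ : EuclideanSpace ℝ (Fin 3) → ℝ) y‖ ≤ Ym := fun m =>
    (hη₀cs.iteratedFDeriv (𝕜 := ℝ) m).exists_bound_of_continuous (hη₀s.continuous_iteratedFDeriv (by exact_mod_cast le_top))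
  choose Y' hY' using hYex
  set Y : ℕ → ℝ := fun m => max (Y' m) 0 with hYdef
  have hY0 : ∀ m, 0 ≤ Y m := fun m => le_max_right _ _
  have hY : ∀ m y, ‖iteratedFDeriv ℝ m (η₀ : EuclideanSpace ℝ (Fin 3) → ℝ) y‖ ≤ Y m := fun m y => (hY' m y).trans (le_max_left _ _)
  set Yn : ℝ := ∑ m ∈ Finset.range (n + 2), Y m with hYn
  have hYn0 : 0 ≤ Yn := Finset.sum_nonneg fun m _ => hY0 m
  have hYle : ∀ m ≤ n + 1, Y m ≤ Yn := fun m hm => Finset.single_le_sum (fun i _ => hY0 i) (Finset.mem_range.2 (by omega))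
  -- the slice structure and the elliptic constants
  obtain ⟨𝒱, h𝒱0, hSS⟩ := exists_slice_structure n hγ0 hγ1 hρ₃0 hρ₃ρ hρ hKb αu hAd0 h𝒞
  obtain ⟨𝓛, h𝓛⟩ := PoissonWeyl.exists_norm_iteratedFDeriv_newtonFarSmoothing_le h₀ h₁
  set 𝓛o : ℕ → ℝ := fun m => max (𝓛 m) 0 with h𝓛o
  have h𝓛o0 : ∀ m, 0 ≤ 𝓛o m := fun m => le_max_right _ _
  set 𝓛n : ℝ := ∑ m ∈ Finset.range (n + 4), 𝓛o m with h𝓛n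
  have h𝓛n0 : 0 ≤ 𝓛n := Finset.sum_nonneg fun m _ => h𝓛o0 m
  have h𝓛le : ∀ m ≤ n + 3, 𝓛o m ≤ 𝓛n := fun m hm => Finset.single_le_sum (fun i _ => h𝓛o0 i) (Finset.mem_range.2 (by omega))
  obtain ⟨KL, hKL0, hKL⟩ := HolderLeibniz.exists_leibniz_holder (E := EuclideanSpace ℝ (Fin 3)) n
  obtain ⟨CT, hCT0, hCT⟩ := exists_newtonNear_level_bounds n hγ0 hγ1 h₀ h₁
  set Mf : ℝ := KL * (2 * Yn + 3 * 𝒱) ^ 2 with hMf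
  have hMf0 : 0 ≤ Mf := by rw [hMf]; positivity
  set c₁ : ℝ := 𝒱 + (2 * (𝓛n * 𝒱) + CT * Mf) with hc₁
  have hc₁0 : 0 ≤ c₁ := by rw [hc₁]; positivity
  refine ⟨3 * c₁, by positivity, ?_⟩
  intro T' x₀ u₀ u p Tb Tb' hm₀ hu hTb hTbTb' hTb'T' hTb1 hu₀s hAd hbd hαu R hRm hRn hRb hRH hRu
  obtain ⟨V, Q, hVm, hVc, hVb, hVH, hQm, hQi, hQ1, hident⟩ :=
    hSS hm₀ hu hTb hTbTb' hTb'T' hTb1 hu₀s hAd hbd hαu R hRm hRn hRb hRH hRu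
  /- ## the objects at `x₀` -/
  set η : (EuclideanSpace ℝ (Fin 3)) → ℝ := fun x => η₀ (x - x₀) with hηdef
  have hηs : ContDiff ℝ (⊤ : ℕ∞) η := hη₀s.comp (contDiff_id.sub contDiff_const)
  have hηY : ∀ m y, ‖iteratedFDeriv ℝ m η y‖ ≤ Y m := fun m y => by
    rw [show iteratedFDeriv ℝ m η y = iteratedFDeriv ℝ m (η₀ : EuclideanSpace ℝ (Fin 3) → ℝ) (y - x₀) from iteratedFDeriv_comp_sub m x₀ y]
    exact hY m _
  have hηsupp : tsupport η ⊆ closedBall x₀ ρ := by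
    refine closure_minimal (fun y hy => ?_) isClosed_closedBall
    have h1 : y - x₀ ∈ tsupport (η₀ : EuclideanSpace ℝ (Fin 3) → ℝ) := subset_tsupport _ (by simpa [hηdef] using hy)
    rw [hη₀supp, mem_closedBall, dist_zero_right] at h1
    rwa [mem_closedBall, dist_eq_norm]
  have hηcs : HasCompactSupport η := HasCompactSupport.of_support_subset_isCompact (isCompact_closedBall x₀ ρ)
    ((subset_tsupport η).trans hηsupp)
  have hηone : ∀ y ∈ closedBall x₀ ρ₃, η y = 1 := fun y hy => by
    simp only [hηdef]
    exact hη₀one _ (by rw [mem_closedBall, dist_zero_right]; rwa [mem_closedBall, dist_eq_norm] at hy)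
  -- the far data and its smoothing
  set G : ℝ → (EuclideanSpace ℝ (Fin 3)) → ℝ := fun t => (ball x₀ ρ₃).indicator (Q t) with hG
  have hGi : ∀ t, Integrable (G t) volume := fun t => ((hQi t).indicator measurableSet_ball)
  have hG1 : ∀ t, ∫ y, ‖G t y‖ ≤ 𝒱 := fun t => by
    refine le_trans (integral_mono (hGi t).norm (hQi t).norm fun y => ?_) (hQ1 t)
    simp only [hG]
    exact norm_indicator_le_norm_self _ _
  set SΛ : ℝ → (EuclideanSpace ℝ (Fin 3)) → ℝ := fun t => newtonFarSmoothing (δ₀ / 2) δ₀ (G t) with hSΛ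
  have hSΛs : ∀ t, ContDiff ℝ (⊤ : ℕ∞) (SΛ t) := fun t => PoissonWeyl.contDiff_newtonFarSmoothing_of_integrable h₀ h₁ (hGi t)
  have hSΛ1 : ∀ t, ContDiff ℝ 1 (SΛ t) := fun t => (hSΛs t).of_le (by exact_mod_cast le_top)
  have hSΛB : ∀ t, ∀ m ≤ n + 3, ∀ x, ‖iteratedFDeriv ℝ m (SΛ t) x‖ ≤ 𝓛n * 𝒱 := by
    intro t m hm x
    calc _ ≤ 𝓛 m * ∫ y, ‖G t y‖ := h𝓛 (G t) (hGi t) m x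
      _ ≤ 𝓛o m * ∫ y, ‖G t y‖ := mul_le_mul_of_nonneg_right (le_max_left _ _) (integral_nonneg fun _ => norm_nonneg _)
      _ ≤ 𝓛n * 𝒱 := mul_le_mul (h𝓛le m hm) (hG1 t) (integral_nonneg fun _ => norm_nonneg _) h𝓛n0
  have hdSΛ : ∀ t (k : Fin 3), ContDiff ℝ (n + 1) (fun x => fderiv ℝ (SΛ t) x (b k)) ∧
      (∀ m ≤ n + 1, ∀ x, ‖iteratedFDeriv ℝ m (fun x => fderiv ℝ (SΛ t) x (b k)) x‖ ≤ 2 * (𝓛n * 𝒱)) ∧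
      ∀ x y, ‖iteratedFDeriv ℝ (n + 1) (fun x => fderiv ℝ (SΛ t) x (b k)) x -
        iteratedFDeriv ℝ (n + 1) (fun x => fderiv ℝ (SΛ t) x (b k)) y‖ ≤ 2 * (𝓛n * 𝒱) * ‖x - y‖ ^ γ := by
    intro t k
    have h2 : ContDiff ℝ ((n + 2 + 1 : ℕ) : ℕ∞) (SΛ t) := (hSΛs t).of_le (by exact_mod_cast le_top)
    obtain ⟨a1, a2, a3⟩ := level_of_succ_bound (m := n + 2) h2 (fun k hk x => hSΛB t k (by omega) x) hγ0 hγ1.le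
    exact level_fderiv_apply a1 a2 a3 (hb1 k).le
  -- the divergence of `V` and the Poisson source
  set divV : ℝ → (EuclideanSpace ℝ (Fin 3)) → ℝ := fun t x => ∑ k, fderiv ℝ (V k t) x (b k) with hdivV
  have hdivVL : ∀ t, ContDiff ℝ n (divV t) ∧ (∀ m ≤ n, ∀ x, ‖iteratedFDeriv ℝ m (divV t) x‖ ≤ 3 * 𝒱) ∧
      ∀ x y, ‖iteratedFDeriv ℝ n (divV t) x - iteratedFDeriv ℝ n (divV t) y‖ ≤ 3 * 𝒱 * ‖x - y‖ ^ γ := by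
    intro t
    have hk : ∀ k : Fin 3, _ := fun k => level_fderiv_apply (hVc k t) (hVb k t) (hVH k t) (hb1 k).le
    exact level_sum3 (fun k => (hk k).1) (fun k => (hk k).2.1) (fun k => (hk k).2.2)
  set f : ℝ → (EuclideanSpace ℝ (Fin 3)) → ℝ := fun t x => η x * divV t x with hf
  have hfL : ∀ t, ContDiff ℝ n (f t) ∧ (∀ m ≤ n, ∀ x, ‖iteratedFDeriv ℝ m (f t) x‖ ≤ Mf) ∧
      ∀ x y, ‖iteratedFDeriv ℝ n (f t) x - iteratedFDeriv ℝ n (f t) y‖ ≤ Mf * ‖x - y‖ ^ γ := by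
    intro t
    obtain ⟨e1, e2, e3⟩ := HolderLeibniz.hyp_of_succ (hηs.of_le (by exact_mod_cast le_top) : ContDiff ℝ (n + 1) η)
      (fun k hk x => (hηY k x).trans (hYle k hk)) hγ0 hγ1.le
    obtain ⟨d1, d2, d3⟩ := hdivVL t
    set M : ℝ := 2 * Yn + 3 * 𝒱 with hM
    have hM0 : 0 ≤ M := by rw [hM]; positivity
    have hB := hKL (ContinuousLinearMap.mul ℝ ℝ) hγ0 hγ1.le hM0 e1 d1
      (level_mono (by rw [hM]; linarith) e2 e3).1 (level_mono (by rw [hM]; linarith) d2 d3).1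
      (level_mono (by rw [hM]; linarith) e2 e3).2 (level_mono (by rw [hM]; linarith) d2 d3).2
    have eB : (fun y => (ContinuousLinearMap.mul ℝ ℝ) (η y) (divV t y)) = f t := by funext y; simp [hf]
    rw [eB] at hB
    have hBn : KL * ‖ContinuousLinearMap.mul ℝ ℝ‖ * M ^ 2 ≤ Mf := by
      calc KL * ‖ContinuousLinearMap.mul ℝ ℝ‖ * M ^ 2 ≤ KL * 1 * M ^ 2 := by
            gcongr; exact ContinuousLinearMap.opNorm_mul_le ℝ ℝ
        _ = Mf := by rw [hMf, hM]; ring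
    exact ⟨e1.mul d1, (level_mono hBn hB.1 hB.2).1, (level_mono hBn hB.1 hB.2).2⟩
  have hfc : ∀ t, Continuous (f t) := fun t => (hfL t).1.continuous
  have hfcs : ∀ t, HasCompactSupport (f t) := fun t => hηcs.mul_right
  -- the near gradient potentials
  set T : ℝ → Fin 3 → (EuclideanSpace ℝ (Fin 3)) → ℝ := fun t k => newtonNearGradPotential (δ₀ / 2) δ₀ (b k) (f t) with hT
  have hTL : ∀ t k, ContDiff ℝ (n + 1) (T t k) ∧ (∀ m ≤ n + 1, ∀ x, ‖iteratedFDeriv ℝ m (T t k) x‖ ≤ CT * Mf) ∧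
      ∀ x y, ‖iteratedFDeriv ℝ (n + 1) (T t k) x - iteratedFDeriv ℝ (n + 1) (T t k) y‖ ≤ CT * Mf * ‖x - y‖ ^ γ := by
    intro t k
    obtain ⟨h1, h2, h3⟩ := hCT hMf0 (hfL t).1 (hfL t).2.1 (hfL t).2.2 (b k)
    rw [hb1, mul_one] at h2 h3
    exact ⟨h1, h2, h3⟩
  /- ## the new representative -/
  set Rk : ℝ → Fin 3 → (EuclideanSpace ℝ (Fin 3)) → ℝ := fun t k x =>
    V k t x + -(fderiv ℝ (SΛ t) x (b k) + T t k x) with hRk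
  set R' : ℝ → (EuclideanSpace ℝ (Fin 3)) → (EuclideanSpace ℝ (Fin 3)) := fun t x => ∑ k, Rk t k x • b k with hR'
  have hRkL : ∀ t k, ContDiff ℝ (n + 1) (Rk t k) ∧ (∀ m ≤ n + 1, ∀ x, ‖iteratedFDeriv ℝ m (Rk t k) x‖ ≤ c₁) ∧
      ∀ x y, ‖iteratedFDeriv ℝ (n + 1) (Rk t k) x - iteratedFDeriv ℝ (n + 1) (Rk t k) y‖ ≤ c₁ * ‖x - y‖ ^ γ := by
    intro t k
    obtain ⟨a1, a2, a3⟩ := hdSΛ t k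
    obtain ⟨b1', b2, b3⟩ := hTL t k
    obtain ⟨c1, c2, c3⟩ := level_add a1 a2 a3 b1' b2 b3
    obtain ⟨d1, d2, d3⟩ := level_neg c1 c2 c3
    exact level_add (hVc k t) (hVb k t) (hVH k t) d1 d2 d3
  have hR'L : ∀ t, ContDiff ℝ (n + 1) (R' t) ∧ (∀ m ≤ n + 1, ∀ x, ‖iteratedFDeriv ℝ m (R' t) x‖ ≤ 3 * c₁) ∧
      ∀ x y, ‖iteratedFDeriv ℝ (n + 1) (R' t) x - iteratedFDeriv ℝ (n + 1) (R' t) y‖ ≤ 3 * c₁ * ‖x - y‖ ^ γ := by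
    intro t
    have hk : ∀ k : Fin 3, _ := fun k => level_smul_const (hRkL t k).1 (hRkL t k).2.1 (hRkL t k).2.2 (hb1 k).le
    exact level_sum3 (fun k => (hk k).1) (fun k => (hk k).2.1) (fun k => (hk k).2.2)
  /- ## measurability of `R'` -/
  have hmeas_fd : ∀ {Gf : ℝ → (EuclideanSpace ℝ (Fin 3)) → ℝ}, StronglyMeasurable (uncurry Gf) →
      (∀ t, Differentiable ℝ (Gf t)) → ∀ v : EuclideanSpace ℝ (Fin 3),
      StronglyMeasurable fun w : ℝ × EuclideanSpace ℝ (Fin 3) => fderiv ℝ (Gf w.1) w.2 v := by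
    intro Gf hGm hGd v
    have h := HeatHolder.stronglyMeasurable_fderiv_family hGm hGd
    exact (ContinuousLinearMap.apply ℝ ℝ v).continuous.comp_stronglyMeasurable h
  -- the far data jointly
  have hGm : Measurable fun w : ℝ × EuclideanSpace ℝ (Fin 3) => G w.1 w.2 := by
    have e : (fun w : ℝ × EuclideanSpace ℝ (Fin 3) => G w.1 w.2) =
        fun w => if w.2 ∈ ball x₀ ρ₃ then uncurry Q w else 0 := by
      funext w
      simp only [hG, indicator, uncurry]
    rw [e]
    exact Measurable.ite (measurable_snd measurableSet_ball) hQm measurable_const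
  have hSΛm : StronglyMeasurable (uncurry SΛ) := by
    have e : uncurry SΛ = fun w : ℝ × EuclideanSpace ℝ (Fin 3) => ∫ z, newtonFarLaplacian (δ₀ / 2) δ₀ z * G w.1 (w.2 - z) := by
      funext w; rfl
    rw [e]
    have hI : Measurable fun q : (ℝ × EuclideanSpace ℝ (Fin 3)) × EuclideanSpace ℝ (Fin 3) =>
        newtonFarLaplacian (δ₀ / 2) δ₀ q.2 * G q.1.1 (q.1.2 - q.2) := by
      refine ((contDiff_newtonFarLaplacian h₀ h₁ (n := 0)).continuous.measurable.comp measurable_snd).mul ?_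
      have : (fun q : (ℝ × EuclideanSpace ℝ (Fin 3)) × EuclideanSpace ℝ (Fin 3) => G q.1.1 (q.1.2 - q.2)) =
          (fun w : ℝ × EuclideanSpace ℝ (Fin 3) => G w.1 w.2) ∘ fun q => (q.1.1, q.1.2 - q.2) := rfl
      rw [this]
      exact hGm.comp (measurable_fst.fst.prodMk (measurable_fst.snd.sub measurable_snd))
    exact hI.stronglyMeasurable.integral_prod_right'
  have hdSΛm : ∀ k, StronglyMeasurable fun w : ℝ × EuclideanSpace ℝ (Fin 3) => fderiv ℝ (SΛ w.1) w.2 (b k) := fun k =>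
    hmeas_fd hSΛm (fun t => (hSΛ1 t).differentiable one_ne_zero) (b k)
  -- the source jointly
  have hdivVm : Measurable fun w : ℝ × EuclideanSpace ℝ (Fin 3) => divV w.1 w.2 := by
    have e : (fun w : ℝ × EuclideanSpace ℝ (Fin 3) => divV w.1 w.2) = fun w => ∑ k, fderiv ℝ (V k w.1) w.2 (b k) := by
      funext w; rfl
    rw [e]
    refine Finset.measurable_sum _ fun k _ => ?_
    exact (hmeas_fd (hVm k) (fun t => (hVc k t).differentiable (by simp)) (b k)).measurable
  have hfm : Measurable fun w : ℝ × EuclideanSpace ℝ (Fin 3) => f w.1 w.2 :=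
    (hηs.continuous.measurable.comp measurable_snd).mul hdivVm
  have hTm : ∀ k, StronglyMeasurable fun w : ℝ × EuclideanSpace ℝ (Fin 3) => T w.1 k w.2 := by
    intro k
    have e : (fun w : ℝ × EuclideanSpace ℝ (Fin 3) => T w.1 k w.2) =
        fun w => ∫ y, newtonNearGrad (δ₀ / 2) δ₀ (b k) (w.2 - y) • f w.1 y := by
      funext w; rfl
    rw [e]
    have hI : Measurable fun q : (ℝ × EuclideanSpace ℝ (Fin 3)) × EuclideanSpace ℝ (Fin 3) =>
        newtonNearGrad (δ₀ / 2) δ₀ (b k) (q.1.2 - q.2) • f q.1.1 q.2 := by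
      refine ((measurable_newtonNearGrad _ _ _).comp (measurable_fst.snd.sub measurable_snd)).smul ?_
      have : (fun q : (ℝ × EuclideanSpace ℝ (Fin 3)) × EuclideanSpace ℝ (Fin 3) => f q.1.1 q.2) =
          (fun w : ℝ × EuclideanSpace ℝ (Fin 3) => f w.1 w.2) ∘ fun q => (q.1.1, q.2) := rfl
      rw [this]
      exact hfm.comp (measurable_fst.fst.prodMk measurable_snd)
    exact hI.stronglyMeasurable.integral_prod_right'
  have hR'm : StronglyMeasurable (uncurry R') := by
    have e : uncurry R' = fun w : ℝ × EuclideanSpace ℝ (Fin 3) =>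
        ∑ k, (uncurry (V k) w + -(fderiv ℝ (SΛ w.1) w.2 (b k) + T w.1 k w.2)) • b k := by
      funext w; rfl
    rw [e]
    refine Finset.stronglyMeasurable_fun_sum _ fun k _ => ?_
    exact (((hVm k).add ((hdSΛm k).add (hTm k)).neg).smul_const (b k))
  /- ## the identification for a.e. time -/
  refine ⟨R', hR'm, fun t => (hR'L t).1, fun t => (hR'L t).2.1, fun t => (hR'L t).2.2, ?_⟩
  filter_upwards [hident] with t ht
  obtain ⟨hφid, hdivt, hloct⟩ := ht
  have hb_inner : ∀ (w : EuclideanSpace ℝ (Fin 3)) (L : EuclideanSpace ℝ (Fin 3) →L[ℝ] ℝ),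
      L w = ∑ k, ⟪w, b k⟫ * L (b k) := by
    intro w L
    conv_lhs => rw [← b.sum_repr' w]
    rw [map_sum]
    refine Finset.sum_congr rfl fun k _ => ?_
    rw [map_smul, smul_eq_mul, real_inner_comm]
  -- integrability helpers
  have hIu : ∀ {φ : (EuclideanSpace ℝ (Fin 3)) → ℝ}, Continuous φ → HasCompactSupport φ → ∀ k,
      Integrable (fun x => ⟪u t x, b k⟫ * φ x) volume := by
    intro φ hφc hφcs k
    have h1 := (hloct.integrable_smul_left_of_hasCompactSupport hφc hφcs).inner_const (𝕜 := ℝ) (b k)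
    refine h1.congr (Eventually.of_forall fun x => ?_)
    beta_reduce
    rw [real_inner_smul_left, mul_comm]
  have hIc : ∀ {g φ : (EuclideanSpace ℝ (Fin 3)) → ℝ}, Continuous g → Continuous φ → HasCompactSupport φ →
      Integrable (fun x => g x * φ x) volume := fun hg hφc hφcs => (hg.mul hφc).integrable_of_hasCompactSupport hφcs.mul_left
  -- ### the very weak Poisson equation of `Q(t)`
  have hpoisson : ∀ ξ : (EuclideanSpace ℝ (Fin 3)) → ℝ,
      FunctionSpaces.IsTestFunctionOn (⟨ball x₀ ρ₃, isOpen_ball⟩ : Opens (EuclideanSpace ℝ (Fin 3))) ξ →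
      ∫ x in ball x₀ ρ₃, Q t x * (Δ ξ) x = ∫ x, f t x * ξ x := by
    intro ξ hξ
    have hξ' : FunctionSpaces.IsTestFunctionOn (⊤ : Opens (EuclideanSpace ℝ (Fin 3))) ξ :=
      ⟨hξ.contDiff, hξ.hasCompactSupport, fun _ _ => trivial⟩
    have hξc : Continuous ξ := hξ.contDiff.continuous
    have hξcs : HasCompactSupport ξ := hξ.hasCompactSupport
    have hξ1 : ContDiff ℝ 1 ξ := hξ.contDiff.of_le (by exact_mod_cast le_top)
    have hξ2 : ContDiff ℝ ((2 : ℕ) : ℕ∞) ξ := hξ.contDiff.of_le (by exact_mod_cast le_top)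
    have hsuppξ : ∀ x, ξ x ≠ 0 → x ∈ ball x₀ ρ₃ := fun x hx => hξ.tsupport_subset (subset_tsupport _ hx)
    -- the derivative tests `∂_kξ`
    have hdξT : ∀ k, FunctionSpaces.IsTestFunctionOn (⟨ball x₀ ρ₃, isOpen_ball⟩ : Opens (EuclideanSpace ℝ (Fin 3)))
        (fun x => fderiv ℝ ξ x (b k)) := fun k =>
      ⟨(hξ.contDiff.fderiv_right (m := (⊤ : ℕ∞)) le_rfl).clm_apply contDiff_const, hξcs.fderiv_apply (𝕜 := ℝ) (b k),
        (tsupport_fderiv_apply_subset ℝ (b k)).trans hξ.tsupport_subset⟩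
    have hdξc : ∀ k, Continuous fun x => fderiv ℝ ξ x (b k) := fun k => (hdξT k).contDiff.continuous
    have hdξcs : ∀ k, HasCompactSupport fun x => fderiv ℝ ξ x (b k) := fun k => (hdξT k).hasCompactSupport
    have hddξc : ∀ k, Continuous fun x => fderiv ℝ (fun y => fderiv ℝ ξ y (b k)) x (b k) := fun k =>
      (((hdξT k).contDiff.continuous_fderiv (by simp)).clm_apply continuous_const)
    -- the slice identities tested with `∂_kξ`
    have E : ∀ k, ∫ x, ⟪u t x, b k⟫ * fderiv ℝ ξ x (b k) =
        (∫ x, V k t x * fderiv ℝ ξ x (b k)) + ∫ x, Q t x * fderiv ℝ (fun y => fderiv ℝ ξ y (b k)) x (b k) :=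
      fun k => hφid _ (hdξT k) k
    -- divergence free: `Σ_k ∫ u_k ∂_kξ = 0`
    have hdiv0 : ∑ k, ∫ x, ⟪u t x, b k⟫ * fderiv ℝ ξ x (b k) = 0 := by
      have h := hdivt ξ hξ'
      rw [← integral_finsetSum _ fun k _ => hIu (hdξc k) (hdξcs k) k]
      rw [← h]
      refine integral_congr_ae (Eventually.of_forall fun x => ?_)
      beta_reduce
      rw [inner_gradient_right, RCLike.conj_to_real, hb_inner (u t x) (fderiv ℝ ξ x)]
    -- sum of the slice identities
    have hsumE : (∑ k, ∫ x, V k t x * fderiv ℝ ξ x (b k)) +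
        ∑ k, ∫ x, Q t x * fderiv ℝ (fun y => fderiv ℝ ξ y (b k)) x (b k) = 0 := by
      rw [← Finset.sum_add_distrib, ← hdiv0]
      exact (Finset.sum_congr rfl fun k _ => (E k).symm)
    -- `Σ_k ∫ Q ∂_k∂_kξ = ∫ Q Δξ`
    have hIQ : ∀ k, Integrable (fun x => Q t x * fderiv ℝ (fun y => fderiv ℝ ξ y (b k)) x (b k)) volume := by
      intro k
      obtain ⟨C, hC⟩ := (hddξc k).bounded_above_of_compact_support ((hdξcs k).fderiv_apply (𝕜 := ℝ) (b k))
      have h := (hQi t).bdd_mul (hddξc k).aestronglyMeasurable (Eventually.of_forall hC)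
      exact h.congr (Eventually.of_forall fun x => by ring)
    have hQΔ : ∑ k, ∫ x, Q t x * fderiv ℝ (fun y => fderiv ℝ ξ y (b k)) x (b k) = ∫ x in ball x₀ ρ₃, Q t x * (Δ ξ) x := by
      rw [← integral_finsetSum _ fun k _ => hIQ k]
      have e1 : ∫ x in ball x₀ ρ₃, Q t x * (Δ ξ) x = ∫ x, Q t x * (Δ ξ) x := by
        refine setIntegral_eq_integral_of_forall_compl_eq_zero fun x hx => ?_
        rw [laplacian_eq_zero_of_notMem_tsupport (fun h => hx (hξ.tsupport_subset h)), mul_zero]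
      rw [e1]
      refine integral_congr_ae (Eventually.of_forall fun x => ?_)
      beta_reduce
      rw [laplacian_eq_sum_fderiv_fderiv b hξ2 x, Finset.mul_sum]
    -- `Σ_k ∫ V_k ∂_kξ = -∫ div V ξ`
    have hVdiv : ∑ k, ∫ x, V k t x * fderiv ℝ ξ x (b k) = -∫ x, divV t x * ξ x := by
      have h1 : ∀ k, ∫ x, V k t x * fderiv ℝ ξ x (b k) = -∫ x, fderiv ℝ (V k t) x (b k) * ξ x := fun k =>
        PoissonWeyl.integral_mul_fderiv_apply_eq_neg ((hVc k t).of_le (by exact_mod_cast (show (1 : ℕ) ≤ n + 1 by omega)))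
          hξ1 hξcs (b k)
      simp_rw [h1]
      rw [Finset.sum_neg_distrib, ← integral_finsetSum _ fun k _ => hIc
        ((((hVc k t).of_le (by exact_mod_cast (show (1 : ℕ) ≤ n + 1 by omega)) : ContDiff ℝ 1 _).continuous_fderiv
          one_ne_zero).clm_apply continuous_const) hξc hξcs]
      congr 1
      refine integral_congr_ae (Eventually.of_forall fun x => ?_)
      simp only [hdivV, Finset.sum_mul]
    -- conclude
    have hfξ : ∫ x, f t x * ξ x = ∫ x, divV t x * ξ x := by
      refine integral_congr_ae (Eventually.of_forall fun x => ?_)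
      beta_reduce
      by_cases hx : ξ x = 0
      · rw [hx, mul_zero, mul_zero]
      · simp only [hf]
        rw [hηone x (ball_subset_closedBall (hsuppξ x hx)), one_mul]
    rw [hfξ, ← hQΔ]
    linarith
  -- ### the weak identification on the inner ball
  have hweak : ∀ (k : Fin 3) (ξ : (EuclideanSpace ℝ (Fin 3)) → ℝ),
      FunctionSpaces.IsTestFunctionOn (⟨ball x₀ (ρ₃ - δ₀), isOpen_ball⟩ : Opens (EuclideanSpace ℝ (Fin 3))) ξ →
      ∫ x, ξ x • (⟪u t x, b k⟫ - Rk t k x) = 0 := by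
    intro k ξ hξ
    have hξ3 : FunctionSpaces.IsTestFunctionOn (⟨ball x₀ ρ₃, isOpen_ball⟩ : Opens (EuclideanSpace ℝ (Fin 3))) ξ :=
      ⟨hξ.contDiff, hξ.hasCompactSupport, hξ.tsupport_subset.trans (ball_subset_ball (by linarith))⟩
    have hξc : Continuous ξ := hξ.contDiff.continuous
    have hξcs : HasCompactSupport ξ := hξ.hasCompactSupport
    have E := hφid ξ hξ3 k
    have PW := PoissonWeyl.integral_mul_fderiv_apply_eq_of_veryWeakPoisson h₀ h₁ (c := x₀) (R := ρ₃)
      ((hQi t).integrableOn) (hfc t) (hfcs t) hpoisson hξ (b k)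
    have hcont : Continuous fun x => fderiv ℝ (SΛ t) x (b k) + T t k x := (hdSΛ t k).1.continuous.add (hTL t k).1.continuous
    have e1 : ∫ x, ξ x • (⟪u t x, b k⟫ - Rk t k x) = (∫ x, ⟪u t x, b k⟫ * ξ x) -
        ((∫ x, V k t x * ξ x) - ∫ x, (fderiv ℝ (SΛ t) x (b k) + T t k x) * ξ x) := by
      have i2 := integral_sub (hIc (hVc k t).continuous hξc hξcs) (hIc hcont hξc hξcs)
      have i12 : Integrable (fun x => V k t x * ξ x - (fderiv ℝ (SΛ t) x (b k) + T t k x) * ξ x) volume :=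
        (hIc (hVc k t).continuous hξc hξcs).sub (hIc hcont hξc hξcs)
      have i1 := integral_sub (hIu hξc hξcs k) i12
      beta_reduce at i1 i2
      rw [← i2, ← i1]
      refine integral_congr_ae (Eventually.of_forall fun x => ?_)
      simp only [hRk, smul_eq_mul]
      ring
    rw [e1, E, PW]
    ring
  have hae : ∀ k, ∀ᵐ x ∂(volume : Measure (EuclideanSpace ℝ (Fin 3))), x ∈ ball x₀ (ρ₃ - δ₀) → ⟪u t x, b k⟫ - Rk t k x = 0 := by
    intro k
    refine isOpen_ball.ae_eq_zero_of_integral_contDiff_smul_eq_zero ?_ (fun g hg hgc hgs => hweak k g ⟨hg, hgc, hgs⟩)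
    have h1 : LocallyIntegrable (fun x => ⟪u t x, b k⟫) volume := by
      rw [locallyIntegrable_iff]
      intro K' hK'
      exact (hloct.integrableOn_isCompact hK').inner_const (𝕜 := ℝ) (b k)
    exact (h1.sub (hRkL t k).1.continuous.locallyIntegrable).locallyIntegrableOn _
  have hae' := ae_all_iff.2 hae
  rw [ae_restrict_iff' measurableSet_ball]
  filter_upwards [hae'] with x hx hxB
  have hx4 : x ∈ ball x₀ (ρ₃ - δ₀) := ball_subset_ball (by linarith [hρ'₃]) hxB
  have hk : ∀ k, Rk t k x = ⟪u t x, b k⟫ := fun k => (sub_eq_zero.1 (hx k hx4)).symm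
  simp only [hR', hk]
  conv_rhs => rw [← b.sum_repr' (u t x)]
  exact Finset.sum_congr rfl fun k _ => by rw [real_inner_comm]

end JiaSverak2014

end Literature.Analysis.FluidPDE
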